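import Summits.BirchSwinnertonDyer.Rank1Residual.X4.KuriharaLowerHalf
import Summits.BirchSwinnertonDyer.BirchSwinnertonDyer.Theorems.TwoAdicConverseLambdaHalfDefs
import Summits.BirchSwinnertonDyer.BirchSwinnertonDyer.Theorems.Rank1ResidualX1Defs
import Summits.BirchSwinnertonDyer.BirchSwinnertonDyer.Theorems.ByReductionTypeAtTwoOrdMissingLowerBoundDefs
import Mathlib.NumberTheory.LegendreSymbol.Basic
import HarnessLib

/-!
# Sketch — crux-ideate stmt-BirchSwinnertonDyer-19577 (`OrdMissingLowerBoundAtTwo`), ideator 1, round 1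

First lemmas of the two idea cards `lambda-kolyvagin-rigidity-two` (α) and
`kurihara-genus-identity-two` (β), typed over existing declarations only. Nothing is proved here.
-/

noncomputable section

open scoped Classical MatrixGroups ModularForm
open CongruenceSubgroup WeierstrassCurve Literature.NumberTheory.EllipticCurves
  Literature.NumberTheory.EllipticCurves.ModularForms
  Literature.NumberTheory.EllipticCurves.Rank1Residual
  Literature.NumberTheory.EllipticCurves.Rank1Residual.Typed
  Summit.BirchSwinnertonDyer.BirchSwinnertonDyer.Theorems.TwoAdicTwistConverse
  Summit.BirchSwinnertonDyer.BirchSwinnertonDyer.Theorems.Rank1ResidualX1Defs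
open Literature.NumberTheory.DiophantineGeometry.Dioph (ratModP)

set_option autoImplicit false
set_option linter.dupNamespace false

namespace Summit.BirchSwinnertonDyer.BirchSwinnertonDyer.Cruxes.OrdMissingLowerBoundAtTwo.LambdaKolyvaginRigidityTwo

/-- The `c`-SCALED Kurihara number at `2`: `δ^{(c)}_n = ∑_{a ∈ (ℤ/n)ˣ} \overline{c·[a/n]⁺_f} · ∏_{ℓ ∣ n} ψ_ℓ(a) ∈ ℤ/2^k`.
The scaling `c ∈ ℚ` (typically `c = 2^e`) repairs the failure at `2` of Kim's standing hypothesis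
`[r]⁺ ∈ ℤ_(2)` (half-integral plus symbols, e.g. 563a1; conv-1 GEN 8): with `c·[r]⁺ ∈ ℤ_(2)` for all `r`
the reduction is a ring map and `δ^{(c)}_n` is lift-independent. For `c = 1` this is literally
`kuriharaNumber f (2^k) n ψ`. -/
def scaledKuriharaNumberTwo {N : ℕ} (f : CuspForm (Gamma0 N) 2) (c : ℚ) (k n : ℕ) [NeZero n]
    (ψ : (ℓ : ℕ) → (ZMod ℓ)ˣ →* Multiplicative (ZMod (2 ^ k))) : ZMod (2 ^ k) :=
  ∑ a : (ZMod n)ˣ, ratModP (2 ^ k) (c * ratPlusSymbol f (((a : ZMod n).val : ℚ) / n)) *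
    ∏ ℓ ∈ n.primeFactors.attach,
      Multiplicative.toAdd (ψ ℓ.1 (ZMod.unitsMap (Nat.dvd_of_mem_primeFactors ℓ.2) a))

/-- Sanity: at `c = 1` the scaled number is the tree's `kuriharaNumber`. -/
theorem scaledKuriharaNumberTwo_one {N : ℕ} (f : CuspForm (Gamma0 N) 2) (k n : ℕ) [NeZero n]
    (ψ : (ℓ : ℕ) → (ZMod ℓ)ˣ →* Multiplicative (ZMod (2 ^ k))) :
    scaledKuriharaNumberTwo f 1 k n ψ = kuriharaNumber f (2 ^ k) n ψ := by
  simp [scaledKuriharaNumberTwo, kuriharaNumber_def]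

/-- **A SHARP Kurihara witness at `2`** for `(W, D)`: a scaling `c ≠ 0` making every plus symbol
`2`-integral, a level `1 ≤ k ≤ ord₂(Tam W) + ord₂(c) + 1` (Kim's sharp level, shifted by the scaling —
scale-invariant), a square-free `n ∈ 𝒩_k` (Kato–Kim Kolyvagin primes at `2`: `ℓ ∤ 2N`, `ℓ ≡ 1`,
`a_ℓ ≡ ℓ + 1 (mod 2^k)`) whose primes have CYCLIC `2`-torsion mod `ℓ` (i.e. `Frob_ℓ` acts on `E[2]` as a
transposition — the `p = 2` Chebotarev class replacing `p ≥ 5`), surjective discrete logarithms, and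
`δ^{(c)}_n ≠ 0` in `ℤ/2^k`. A FINITE certificate. -/
def SharpKuriharaWitnessAtTwo (W : WeierstrassCurve ℚ) [W.IsElliptic] [W.IsGloballyMinimal]
    {N : ℕ} [NeZero N] (D : ModularParametrizationData W N) : Prop :=
  ∃ (c : ℚ) (k n : ℕ) (_ : NeZero n) (ψ : (ℓ : ℕ) → (ZMod ℓ)ˣ →* Multiplicative (ZMod (2 ^ k))),
    c ≠ 0 ∧ (∀ r : ℚ, ‖((c * ratPlusSymbol D.f r : ℚ) : ℚ_[2])‖ ≤ 1) ∧
    1 ≤ k ∧ ((k : ℤ) ≤ (padicValNat 2 W.tamagawaProduct : ℤ) + padicValRat 2 c + 1) ∧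
    Kato.IsKolyvaginProduct W 2 k n ∧
    (∀ (ℓ : ℕ) [Fact ℓ.Prime], ℓ ∣ n →
      Nat.card {P : ((WeierstrassCurve.integralModelInt W).map
          (Int.castRingHom (ZMod ℓ))).toAffine.Point // 2 • P = 0} ≤ 2) ∧
    (∀ ℓ ∈ n.primeFactors, Function.Surjective (ψ ℓ)) ∧
    scaledKuriharaNumberTwo D.f c k n ψ ≠ 0

/-- **Defect-budget variant (after kit j304479).** On curves with `Δ_E ∈ −ℚ×²` (`ℚ(E[2]) ⊇ ℚ(i)`)
every transposition prime is `≡ 3 (mod 4)`, so transposition Kolyvagin primes of level `≥ 2` do not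
exist; Frob-trivial primes must be admitted, each raising the admissible level by one (observed: mixed
pairs have `ord = e + t + 1` exactly, Frob-trivial pairs `≥ e + t + 2`). `S` = the set of admitted
Frob-trivial primes; the level bound is `k ≤ ord₂ Tam + ord₂ c + 1 + #S`. -/
def BudgetKuriharaWitnessAtTwo (W : WeierstrassCurve ℚ) [W.IsElliptic] [W.IsGloballyMinimal]
    {N : ℕ} [NeZero N] (D : ModularParametrizationData W N) : Prop :=
  ∃ (c : ℚ) (k n : ℕ) (_ : NeZero n) (ψ : (ℓ : ℕ) → (ZMod ℓ)ˣ →* Multiplicative (ZMod (2 ^ k)))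
    (S : Finset ℕ),
    c ≠ 0 ∧ (∀ r : ℚ, ‖((c * ratPlusSymbol D.f r : ℚ) : ℚ_[2])‖ ≤ 1) ∧ S ⊆ n.primeFactors ∧
    1 ≤ k ∧ ((k : ℤ) ≤ (padicValNat 2 W.tamagawaProduct : ℤ) + padicValRat 2 c + 1 + S.card) ∧
    Kato.IsKolyvaginProduct W 2 k n ∧
    (∀ (ℓ : ℕ) [Fact ℓ.Prime], ℓ ∣ n → ℓ ∉ S →
      Nat.card {P : ((WeierstrassCurve.integralModelInt W).map
          (Int.castRingHom (ZMod ℓ))).toAffine.Point // 2 • P = 0} ≤ 2) ∧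
    (∀ ℓ ∈ n.primeFactors, Function.Surjective (ψ ℓ)) ∧
    scaledKuriharaNumberTwo D.f c k n ψ ≠ 0

theorem budgetKuriharaWitnessAtTwo_of_sharp (W : WeierstrassCurve ℚ) [W.IsElliptic]
    [W.IsGloballyMinimal] {N : ℕ} [NeZero N] (D : ModularParametrizationData W N)
    (h : SharpKuriharaWitnessAtTwo W D) : BudgetKuriharaWitnessAtTwo W D := by
  obtain ⟨c, k, n, hn, ψ, hc, hint, hk1, hk, hkol, htyp, hsurj, hne⟩ := h
  refine ⟨c, k, n, hn, ψ, ∅, hc, hint, by simp, hk1, by simpa using hk, hkol, ?_, hsurj, hne⟩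
  intro ℓ _ hℓ _
  exact htyp ℓ hℓ

/-- **FIRST LEMMA of card α (robust form) — `2`-adic Kolyvagin rigidity, `λ`-half.** On the habitat of
the crux (non-CM, good ordinary at `2`) with `ρ̄_{E,2}` onto `GL₂(𝔽₂) ≅ S₃`, analytic rank `0` and an
odd Manin constant, ONE sharp Kurihara witness forces `λ(ϖ·L₂(E)) ≤ λ(X(E/ℚ_∞))`
(`LambdaHalfAtTwo W`, the S3 leaf). Mechanism: the witness bounds the `2`-divisibility defect of Kato's
`Λ`-adic Kolyvagin system at the base layer, every `p = 2` pathology of the Mazur–Rubin/Kim machine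
(`H¹(ℚ(E[2^k])/ℚ, E[2^k]) ≠ 0`, `2` always anomalous, `E(ℚ₂)[2]`, the real place, half-integral
symbols) is `O(1)` uniformly in the cyclotomic tower, and uniformly bounded defects are invisible to
`char_Λ`. Nothing in print at `p = 2`. -/
def KolyvaginRigidityLambdaAtTwo : Prop :=
  ∀ (W : WeierstrassCurve ℚ) [W.IsElliptic] [W.IsGloballyMinimal], ¬ W.HasCM → GoodOrd W 2 →
    W.HasSurjectiveModNGaloisRep 2 → W.analyticRank = 0 →
    ∀ {N : ℕ} [NeZero N] (D : ModularParametrizationData W N), ¬ (2 : ℤ) ∣ D.maninConstant →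
      SharpKuriharaWitnessAtTwo W D → LambdaHalfAtTwo W

/-- **FIRST LEMMA of card α (sharp form).** Same hypotheses; conclusion the full Néron-normalised
main conjecture at `(W, 2)` (`char X = (ϖ·L₂)`): a SHARP witness (level exactly Kim's) makes the
`Λ`-adic defect a unit, `2`-part included. Feeds 19577 through the in-tree doors
`mainConjectureEisensteinDivisibilityAtTwo_of_mazurMainConjecture` and
`missingLowerBoundAt_two_of_eisenstein_of_kato` with NO `μ_an` input. -/
def KolyvaginRigidityAtTwo : Prop :=
  ∀ (W : WeierstrassCurve ℚ) [W.IsElliptic] [W.IsGloballyMinimal], ¬ W.HasCM → GoodOrd W 2 →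
    W.HasSurjectiveModNGaloisRep 2 → W.analyticRank = 0 →
    ∀ {N : ℕ} [NeZero N] (D : ModularParametrizationData W N), ¬ (2 : ℤ) ∣ D.maninConstant →
      SharpKuriharaWitnessAtTwo W D → MazurMainConjecture W 2

/-- **Budget form of `2`-adic Kolyvagin rigidity** (the form the `Δ = −□` sub-habitat needs). -/
def KolyvaginRigidityBudgetAtTwo : Prop :=
  ∀ (W : WeierstrassCurve ℚ) [W.IsElliptic] [W.IsGloballyMinimal],
    ¬ W.HasCM → GoodOrd W 2 → W.HasSurjectiveModNGaloisRep 2 → W.analyticRank = 0 →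
    ∀ {N : ℕ} [NeZero N] (D : ModularParametrizationData W N), ¬ (2 : ℤ) ∣ D.maninConstant →
      BudgetKuriharaWitnessAtTwo W D → MazurMainConjecture W 2

/-- **The analytic supply (card β's target; conjecture-grade, numerically testable per curve):** every
curve of the habitat with `ρ̄_{E,2}` onto and analytic rank `0` carries a sharp Kurihara witness at `2`
for its odd-Manin parametrisations — the `p = 2`, rank-`0` analogue of the refined Kurihara conjecture
(Castella–Sano et al. arXiv:2601.14504 §1.1.3, proved there for ODD `p` from the main conjecture). -/
def SharpWitnessSupplyAtTwo : Prop :=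
  ∀ (W : WeierstrassCurve ℚ) [W.IsElliptic] [W.IsGloballyMinimal], ¬ W.HasCM → GoodOrd W 2 →
    W.HasSurjectiveModNGaloisRep 2 → W.analyticRank = 0 →
    ∀ {N : ℕ} [NeZero N] (D : ModularParametrizationData W N), ¬ (2 : ℤ) ∣ D.maninConstant →
      SharpKuriharaWitnessAtTwo W D

/-- **Budget supply** — the class-wide existence statement in the form the `Δ = −□` curves
(e.g. `2541a1`: `t = 2`, `Ш_an = 4`, no transposition Kolyvagin prime of level `≥ 2`) can satisfy. -/
def BudgetWitnessSupplyAtTwo : Prop :=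
  ∀ (W : WeierstrassCurve ℚ) [W.IsElliptic] [W.IsGloballyMinimal],
    ¬ W.HasCM → GoodOrd W 2 → W.HasSurjectiveModNGaloisRep 2 → W.analyticRank = 0 →
    ∀ {N : ℕ} [NeZero N] (D : ModularParametrizationData W N), ¬ (2 : ℤ) ∣ D.maninConstant →
      BudgetKuriharaWitnessAtTwo W D

theorem mazurMainConjecture_two_of_budgetRigidity_of_budgetSupply
    (hR : KolyvaginRigidityBudgetAtTwo) (hS : BudgetWitnessSupplyAtTwo)
    (W : WeierstrassCurve ℚ) [W.IsElliptic] [W.IsGloballyMinimal]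
    (hcm : ¬ W.HasCM) (hgo : GoodOrd W 2) (hsurj : W.HasSurjectiveModNGaloisRep 2)
    (hr : W.analyticRank = 0) {N : ℕ} [NeZero N] (D : ModularParametrizationData W N)
    (hman : ¬ (2 : ℤ) ∣ D.maninConstant) : MazurMainConjecture W 2 :=
  hR W hcm hgo hsurj hr D hman (hS W hcm hgo hsurj hr D hman)

/-- Composition check (shape only): rigidity (sharp form) and supply give Mazur's main conjecture at `2`
on the `S₃`-slice of the habitat at analytic rank `0`, granted an odd-Manin parametrisation exists. -/
theorem mazurMainConjecture_two_of_rigidity_of_supply (hR : KolyvaginRigidityAtTwo)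
    (hS : SharpWitnessSupplyAtTwo) (W : WeierstrassCurve ℚ) [W.IsElliptic] [W.IsGloballyMinimal]
    (hcm : ¬ W.HasCM) (hgo : GoodOrd W 2) (hsurj : W.HasSurjectiveModNGaloisRep 2)
    (hr : W.analyticRank = 0) {N : ℕ} [NeZero N] (D : ModularParametrizationData W N)
    (hman : ¬ (2 : ℤ) ∣ D.maninConstant) : MazurMainConjecture W 2 :=
  hR W hcm hgo hsurj hr D hman (hS W hcm hgo hsurj hr D hman)

end Summit.BirchSwinnertonDyer.BirchSwinnertonDyer.Cruxes.OrdMissingLowerBoundAtTwo.LambdaKolyvaginRigidityTwo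

namespace Summit.BirchSwinnertonDyer.BirchSwinnertonDyer.Cruxes.OrdMissingLowerBoundAtTwo.KuriharaGenusIdentityTwo

open Summit.BirchSwinnertonDyer.BirchSwinnertonDyer.Cruxes.OrdMissingLowerBoundAtTwo.LambdaKolyvaginRigidityTwo

/-- **FIRST LEMMA of card β — the genus identity for level-one Kurihara numbers at `2`.** For an odd
prime `ℓ` and a scaling `c` making the plus symbols `2`-integral, the mod-`2` Kurihara number at the prime
level `ℓ` (whose discrete logarithm mod `2` IS the Legendre symbol, written additively) equals the
reduction of the rational number `½ (∑_{a ∈ (ℤ/ℓ)ˣ} c[a/ℓ]⁺ − ∑_{a} (a/ℓ) · c[a/ℓ]⁺)` — the second sum is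
Birch's twisted period sum, i.e. `L(f ⊗ χ_ℓ, 1)` up to the Gauss-sum unit, and the first is
`(a_ℓ − 2)·c[0]⁺` by the Hecke relation. Elementary (`1 − χ(a) = 2·𝟙_{non-residue}`); M-sized. -/
def KuriharaGenusIdentityAtTwo : Prop :=
  ∀ {N : ℕ} (f : CuspForm (Gamma0 N) 2) (c : ℚ) (ℓ : ℕ) [Fact ℓ.Prime], ℓ ≠ 2 →
    (∀ r : ℚ, ‖((c * ratPlusSymbol f r : ℚ) : ℚ_[2])‖ ≤ 1) →
    ∀ ψ : (q : ℕ) → (ZMod q)ˣ →* Multiplicative (ZMod (2 ^ 1)), Function.Surjective (ψ ℓ) →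
      scaledKuriharaNumberTwo f c 1 ℓ ψ =
        ratModP (2 ^ 1)
          ((∑ a : (ZMod ℓ)ˣ, c * ratPlusSymbol f (((a : ZMod ℓ).val : ℚ) / ℓ)
            - ∑ a : (ZMod ℓ)ˣ, (legendreSym ℓ ((a : ZMod ℓ).val : ℤ) : ℚ) *
                (c * ratPlusSymbol f (((a : ZMod ℓ).val : ℚ) / ℓ))) / 2)

/-- **The rank-0 functional-equation bit, genus form (β's second statement, testable):** at a level-`k`
Kolyvagin prime `ℓ ≡ 1 (mod 4)` of a rank-`0` curve the (scaled) Kurihara number is `2^{k-1}`-TORSION-valued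
(conv-1 GEN 8: `2δ̃_ℓ = 0`, 2876/2876; tree `kuriharaSum_primeFactors_eq_sign_mul`), and its one surviving
bit is the parity of `(c(a_ℓ − 2)[0]⁺ − c·G_ℓ)/2^k` with `G_ℓ` the Legendre-twisted sum — a depth-one
congruence between `L(E,1)` and `L(E ⊗ χ_ℓ, 1)` modulo `2^{k+1}`. Typed here only as the torsion claim. -/
def LevelOneTorsionAtTwo : Prop :=
  ∀ (W : WeierstrassCurve ℚ) [W.IsElliptic] [W.IsGloballyMinimal], W.analyticRank = 0 →
    ∀ {N : ℕ} [NeZero N] (D : ModularParametrizationData W N) (c : ℚ) (k ℓ : ℕ) [Fact ℓ.Prime],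
      (∀ r : ℚ, ‖((c * ratPlusSymbol D.f r : ℚ) : ℚ_[2])‖ ≤ 1) → 1 ≤ k →
      Kato.IsKolyvaginPrime W 2 k ℓ →
      ∀ ψ : (q : ℕ) → (ZMod q)ˣ →* Multiplicative (ZMod (2 ^ k)), Function.Surjective (ψ ℓ) →
        2 * scaledKuriharaNumberTwo D.f c k ℓ ψ = 0

end Summit.BirchSwinnertonDyer.BirchSwinnertonDyer.Cruxes.OrdMissingLowerBoundAtTwo.KuriharaGenusIdentityTwo

end
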